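import Summits.QuantumFields.BalabanUV.Beta.GAN24.EffectiveFormRateTransfer

/-!
# `BalabanUV.Beta.GAN24.HardMinimiserRateTransfer` — binder row G-an2-4 ∕ (CONV-C), route R6 «VALUES, NOT DERIVATIVES», PART 112:
# «Ξ's RATE IS THE SOFT COLUMNS' RATE PLUS Σ's RATE» — the one-step mismatch of the HARD minimiser columns under the averaging `Qf` between two consecutive fine
# lattices, `Qf·ℋ′ − ℋ`, entrywise with fine-to-unit decay, from (i) the one-step mismatch of the SOFT columns `Qf·K′⁻¹Q′ᵀ − K⁻¹Qᵀ` (the `G_kQ_k*`-type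
# constituent's one-step law), (ii) the block propagator's rate `|P − P′|` (⟹ Σ's rate, PART 107) and (iii) PART 105's localisation — LINEARLY in (i) and (ii)
# (unit b2b-balaban-gan24-p3, gen 50; v1)

NOT IN PRINT; OUR PROOF (for the ROUTE; [folklore] — `ℋ = K⁻¹Qᵀ·(𝒮 + a•1)` (`CompositionSingular.blocks_eq_of_reg` + `effForm_eq_of_reg`), hence the exact split
`Qf·ℋ′ − ℋ = (Qf·K′⁻¹Q′ᵀ − K⁻¹Qᵀ)·(𝒮′ + a•1) + K⁻¹Qᵀ·(𝒮′ − 𝒮)`; PART 105 `abs_effForm_add_le` ∕ `sum_exp_mul_exp_le` and PART 107 `abs_effForm_sub_effForm_le` BY NAME).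
HONEST FRAMING (cell contract, verbatim): «discharging `BetaPertH` makes Bałaban's UV stability UNCONDITIONAL — a real constructive-QFT result; it is NOT the continuum limit and NOT
the Clay problem.»  HONEST DEPENDENCY (verbatim): «continuum YM on T⁴ ⇐ BetaPertH ∧ nine spine estimates (0/9 proved); BetaPertH ⇐ (D1) ∧ (D4) ∧ CAP+tail; G-an2-4 gates asym, D1
and NE2/3/4.»

WHY THIS FILE.  PARTs 105–107 put the DECAY half of all three blocks `[[𝒢, ℋ],[ℋᵀ, −𝒮]]` and the RATE half of the Σ-block on one soft letter + the `QG_kQ*` block's rate.  The Ξ-block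
(`H_k` = the minimiser columns, an1's `Ξᵀ`) lives on DIFFERENT fine lattices at consecutive levels, so its one-step rate is a statement about `Qf_k·ℋ_{k+1} − ℋ_k` (the tower's
averaged-minimiser mismatch of PART 92, there in ENERGY currency).  THIS FILE types it ENTRYWISE WITH DECAY: the mismatch is the soft columns' mismatch dressed by `𝒮′ + a` plus the
soft columns dressed by Σ's increment — so on the row's list the Ξ-block's rate reduces to the `G_kQ_k*`-block's one-step law (at `U = 1` for the scalar prototype: road P2's
`MinimiserOneStepDecayCubic.fieldDecay_Msoft_succ_sub_stair_cubic`) plus the `QG_kQ*`-block's rate, LINEARLY, with PART 105's constants.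

WHAT THIS FILE PROVES (0 sorry, 0 `def`, nothing cited; PART 105's letters: unit index `c` (pseudo-distance `ρ`, profile `Kf`), fine index sets `ν`, `ν′`, fine-to-unit gauge
`σ : ν → c → ℝ` on the COARSER fine lattice, `K = H + Qᵀ(a•1)Q`, `K′ = H′ + Q′ᵀ(a•1)Q′`, an averaging `Qf : Matrix ν ν′ ℝ`):
* §1 **`minOp_eq_mul`** (`ℋ = K⁻¹Qᵀ·(𝒮 + a•1)` under `K` coercive + UB), **`avg_minOp_sub_eq`** (the exact split of `Qf·ℋ′ − ℋ`).
* §2 **`abs_avg_minOp_sub_le`** — THE END: with the soft-column mismatch `|(Qf·K′⁻¹Q′ᵀ − K⁻¹Qᵀ)(x,b)| ≤ ε₁e^{−δ₁σ(x,b)}`, the soft-column decay `|(K⁻¹Qᵀ)(x,b)| ≤ c₁e^{−δ₁σ(x,b)}`,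
  the block-propagator rate `|(P − P′)(b,b′)| ≤ ε₂e^{−δ₀ρ}` and PART 105's hypotheses for both data:
  `|(Qf·ℋ′ − ℋ)(x,b)| ≤ (2(Λ+a)·ε₁ + 4(Λ+a)²Kf(t∕2)²·c₁·ε₂)·Kf(m∕2)·e^{−(m∕2)σ(x,b)}`, `t = rate Kf (Λ+a)⁻¹ c₀ δ₀`, `m = min δ₁ (t∕2)` — LINEAR in `(ε₁, ε₂)`.
WHAT IT DOES NOT DO: supply the two rate letters (Bałaban-class with background; at `U = 1` road P2's scalar laws); the 𝒢-block's rate; instantiate.  SUPPLIER work on route C-R6°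
(rank 2, REDUCTION); no consumer of record; NEVER «G-an2-4 closed»; NOT (CONV-C), NOT D1, NOT `BetaPertH`, NOT continuum, NOT Clay.  Records: `HOME/b2b-balaban-gan24-p3/gen50/README.md`.
-/

noncomputable section

open scoped BigOperators Matrix
open Finset Matrix
open Literature.MathematicalPhysics.QuantumFieldTheory.Balaban1983to89
open Literature.MathematicalPhysics.QuantumFieldTheory.Balaban1983to89.B4Sect5Torus (IsPseudoDist SumBound rate rate_pos rate_le_delta0)
open Literature.MathematicalPhysics.QuantumFieldTheory.Balaban1983to89.Beta.Composition (kkt blockProp)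
open Literature.MathematicalPhysics.QuantumFieldTheory.Balaban1983to89.Beta.CompositionSingular (effForm minOp blocks_eq_of_reg effForm_eq_of_reg)
open Summit.QuantumFields.BalabanUV.Beta.GAN24.EffectiveFormLocalisation (transpose_reg blockProp_coercive_of_ub isUnit_det_of_coercive
  isUnit_det_of_coercive_fine abs_effForm_add_le sum_exp_mul_exp_le)
open Summit.QuantumFields.BalabanUV.Beta.GAN24.EffectiveFormRateTransfer (abs_effForm_sub_effForm_le)

namespace Summit.QuantumFields.BalabanUV.Beta.GAN24.HardMinimiserRateTransfer

variable {c ν ν' : Type*} [Fintype c] [Fintype ν] [Fintype ν'] [DecidableEq c] [DecidableEq ν] [DecidableEq ν']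
variable {H : Matrix ν ν ℝ} {Q : Matrix c ν ℝ} {H' : Matrix ν' ν' ℝ} {Q' : Matrix c ν' ℝ} {a : ℝ}

/-! ## §1 The hard minimiser as dressed soft columns, and the exact split of its one-step mismatch -/

omit [Fintype ν'] [DecidableEq ν'] in
/-- **`minOp_eq_mul` — `ℋ = K⁻¹Qᵀ·(𝒮 + a•1)`** [our proof; `blocks_eq_of_reg` + `effForm_eq_of_reg`]: `H` symmetric with nonnegative form, `a > 0`, `K = H + Qᵀ(a•1)Q` coercive, upper
bound in trial form ⟹ `minOp H Q = (K⁻¹Qᵀ)·(effForm H Q + a•1)`. -/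
theorem minOp_eq_mul (hH : Hᵀ = H) (hpsd : ∀ z : ν → ℝ, 0 ≤ z ⬝ᵥ (H *ᵥ z)) (ha : 0 < a) {γ : ℝ} (hγ : 0 < γ)
    (hK : QGQInverse.Coercive (H + Qᵀ * (a • (1 : Matrix c c ℝ)) * Q) γ) {Λ : ℝ} (hΛ : 0 ≤ Λ)
    (hUB : ∀ B : c → ℝ, ∃ u : ν → ℝ, Q *ᵥ u = B ∧ u ⬝ᵥ (H *ᵥ u) ≤ Λ * (B ⬝ᵥ B)) :
    minOp H Q = (H + Qᵀ * (a • (1 : Matrix c c ℝ)) * Q)⁻¹ * Qᵀ * (effForm H Q + a • (1 : Matrix c c ℝ)) := by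
  set K : Matrix ν ν ℝ := H + Qᵀ * (a • (1 : Matrix c c ℝ)) * Q with hKdef
  have hΛa : 0 < Λ + a := by linarith
  have hPco : QGQInverse.Coercive (blockProp K Q) (Λ + a)⁻¹ := blockProp_coercive_of_ub hH hpsd ha hγ hK hΛ hUB
  have hKdet : IsUnit K.det := isUnit_det_of_coercive_fine hγ hK
  have hPdet : IsUnit (blockProp K Q).det := isUnit_det_of_coercive (inv_pos.mpr hΛa) hPco
  have hM := (blocks_eq_of_reg H Q (a • (1 : Matrix c c ℝ)) hKdet hPdet).2.1
  have hE : effForm H Q + a • (1 : Matrix c c ℝ) = (blockProp K Q)⁻¹ := by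
    rw [effForm_eq_of_reg H Q (a • (1 : Matrix c c ℝ)) hKdet hPdet, sub_add_cancel]
  rw [hE, hM]

/-- **`avg_minOp_sub_eq` — THE EXACT SPLIT OF THE ONE-STEP MISMATCH**: for an averaging `Qf` between the two fine lattices,
`Qf·ℋ′ − ℋ = (Qf·K′⁻¹Q′ᵀ − K⁻¹Qᵀ)·(𝒮′ + a•1) + K⁻¹Qᵀ·((𝒮′ + a•1) − (𝒮 + a•1))`. [our proof] -/
theorem avg_minOp_sub_eq (Qf : Matrix ν ν' ℝ) (ha : 0 < a) {γ Λ : ℝ} (hγ : 0 < γ) (hΛ : 0 ≤ Λ)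
    (hH : Hᵀ = H) (hpsd : ∀ z : ν → ℝ, 0 ≤ z ⬝ᵥ (H *ᵥ z)) (hK : QGQInverse.Coercive (H + Qᵀ * (a • (1 : Matrix c c ℝ)) * Q) γ)
    (hUB : ∀ B : c → ℝ, ∃ u : ν → ℝ, Q *ᵥ u = B ∧ u ⬝ᵥ (H *ᵥ u) ≤ Λ * (B ⬝ᵥ B))
    (hH' : H'ᵀ = H') (hpsd' : ∀ z : ν' → ℝ, 0 ≤ z ⬝ᵥ (H' *ᵥ z)) (hK' : QGQInverse.Coercive (H' + Q'ᵀ * (a • (1 : Matrix c c ℝ)) * Q') γ)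
    (hUB' : ∀ B : c → ℝ, ∃ u : ν' → ℝ, Q' *ᵥ u = B ∧ u ⬝ᵥ (H' *ᵥ u) ≤ Λ * (B ⬝ᵥ B)) :
    Qf * minOp H' Q' - minOp H Q =
      (Qf * ((H' + Q'ᵀ * (a • (1 : Matrix c c ℝ)) * Q')⁻¹ * Q'ᵀ) - (H + Qᵀ * (a • (1 : Matrix c c ℝ)) * Q)⁻¹ * Qᵀ) *
          (effForm H' Q' + a • (1 : Matrix c c ℝ)) +
        (H + Qᵀ * (a • (1 : Matrix c c ℝ)) * Q)⁻¹ * Qᵀ * ((effForm H' Q' + a • (1 : Matrix c c ℝ)) - (effForm H Q + a • (1 : Matrix c c ℝ))) := by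
  rw [minOp_eq_mul hH hpsd ha hγ hK hΛ hUB, minOp_eq_mul hH' hpsd' ha hγ hK' hΛ hUB']
  simp only [Matrix.sub_mul, Matrix.mul_sub, Matrix.mul_assoc]
  abel

/-! ## §2 The Ξ-block's one-step rate from the soft columns' mismatch and Σ's rate -/

section End

variable {ρ : c → c → ℝ} {Kf : ℝ → ℝ} {σ : ν → c → ℝ}

/-- **`abs_avg_minOp_sub_le` — Ξ's RATE IS THE SOFT COLUMNS' RATE PLUS Σ's RATE, ENTRYWISE WITH DECAY, LINEARLY** [our proof; §1 + PART 105 `abs_effForm_add_le` ∕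
`sum_exp_mul_exp_le` + PART 107 `abs_effForm_sub_effForm_le` BY NAME]: two constrained data `(H, Q)` on `ν` and `(H′, Q′)` on `ν′` over the same unit index set and the same
`a > 0`, each with PART 105's hypotheses (symmetric nonnegative `H`, `K` `γ`-coercive, upper bound `Λ`, `|P| ≤ c₀e^{−δ₀ρ}`), the block-propagator RATE `|(P − P′)(b,b′)| ≤ ε₂e^{−δ₀ρ}`,
a fine-to-unit gauge `σ ≥ 0` on `ν` compatible with `ρ`, the soft-column DECAY `|(K⁻¹Qᵀ)(x,b)| ≤ c₁e^{−δ₁σ(x,b)}` and the soft-column one-step MISMATCH under the averaging `Qf`,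
`|(Qf·K′⁻¹Q′ᵀ − K⁻¹Qᵀ)(x,b)| ≤ ε₁e^{−δ₁σ(x,b)}` ⟹ with `t = rate Kf (Λ+a)⁻¹ c₀ δ₀` and `m = min δ₁ (t∕2)`:
`|(Qf·ℋ′ − ℋ)(x,b)| ≤ (2(Λ+a)·ε₁ + 4(Λ+a)²·Kf(t∕2)²·c₁·ε₂)·Kf(m∕2)·e^{−(m∕2)σ(x,b)}`. -/
theorem abs_avg_minOp_sub_le (hKf : ∀ r, 0 < r → 0 ≤ Kf r) (hρ : IsPseudoDist ρ) (hS : SumBound ρ Kf) (Qf : Matrix ν ν' ℝ) (ha : 0 < a)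
    {γ Λ c₀ δ₀ ε₁ ε₂ c₁ δ₁ : ℝ} (hγ : 0 < γ) (hΛ : 0 ≤ Λ) (hc₀ : 0 ≤ c₀) (hδ₀ : 0 < δ₀) (hε₁ : 0 ≤ ε₁) (hε₂ : 0 ≤ ε₂) (hc₁ : 0 ≤ c₁) (hδ₁ : 0 < δ₁)
    (hH : Hᵀ = H) (hpsd : ∀ z : ν → ℝ, 0 ≤ z ⬝ᵥ (H *ᵥ z)) (hK : QGQInverse.Coercive (H + Qᵀ * (a • (1 : Matrix c c ℝ)) * Q) γ)
    (hUB : ∀ B : c → ℝ, ∃ u : ν → ℝ, Q *ᵥ u = B ∧ u ⬝ᵥ (H *ᵥ u) ≤ Λ * (B ⬝ᵥ B))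
    (hP : ∀ b b', |blockProp (H + Qᵀ * (a • (1 : Matrix c c ℝ)) * Q) Q b b'| ≤ c₀ * Real.exp (-(δ₀ * ρ b b')))
    (hH' : H'ᵀ = H') (hpsd' : ∀ z : ν' → ℝ, 0 ≤ z ⬝ᵥ (H' *ᵥ z)) (hK' : QGQInverse.Coercive (H' + Q'ᵀ * (a • (1 : Matrix c c ℝ)) * Q') γ)
    (hUB' : ∀ B : c → ℝ, ∃ u : ν' → ℝ, Q' *ᵥ u = B ∧ u ⬝ᵥ (H' *ᵥ u) ≤ Λ * (B ⬝ᵥ B))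
    (hP' : ∀ b b', |blockProp (H' + Q'ᵀ * (a • (1 : Matrix c c ℝ)) * Q') Q' b b'| ≤ c₀ * Real.exp (-(δ₀ * ρ b b')))
    (hdiff : ∀ b b', |(blockProp (H + Qᵀ * (a • (1 : Matrix c c ℝ)) * Q) Q -
        blockProp (H' + Q'ᵀ * (a • (1 : Matrix c c ℝ)) * Q') Q') b b'| ≤ ε₂ * Real.exp (-(δ₀ * ρ b b')))
    (hσ0 : ∀ x b, 0 ≤ σ x b) (hσρ : ∀ x b b', σ x b ≤ σ x b' + ρ b' b)
    (hT : ∀ x b, |((H + Qᵀ * (a • (1 : Matrix c c ℝ)) * Q)⁻¹ * Qᵀ) x b| ≤ c₁ * Real.exp (-(δ₁ * σ x b)))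
    (hmis : ∀ x b, |(Qf * ((H' + Q'ᵀ * (a • (1 : Matrix c c ℝ)) * Q')⁻¹ * Q'ᵀ) - (H + Qᵀ * (a • (1 : Matrix c c ℝ)) * Q)⁻¹ * Qᵀ) x b| ≤
      ε₁ * Real.exp (-(δ₁ * σ x b))) (x : ν) (b : c) :
    |(Qf * minOp H' Q' - minOp H Q) x b| ≤
      (2 * (Λ + a) * ε₁ + 4 * (Λ + a) ^ 2 * Kf (rate Kf (Λ + a)⁻¹ c₀ δ₀ / 2) ^ 2 * c₁ * ε₂) *
        Kf (min δ₁ (rate Kf (Λ + a)⁻¹ c₀ δ₀ / 2) / 2) * Real.exp (-(min δ₁ (rate Kf (Λ + a)⁻¹ c₀ δ₀ / 2) / 2 * σ x b)) := by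
  set K : Matrix ν ν ℝ := H + Qᵀ * (a • (1 : Matrix c c ℝ)) * Q with hKdef
  set K' : Matrix ν' ν' ℝ := H' + Q'ᵀ * (a • (1 : Matrix c c ℝ)) * Q' with hK'def
  set t : ℝ := rate Kf (Λ + a)⁻¹ c₀ δ₀ with ht
  have hΛa : 0 < Λ + a := by linarith
  have htpos : 0 < t := rate_pos hKf (inv_pos.mpr hΛa) hc₀ hδ₀
  set m : ℝ := min δ₁ (t / 2) with hm
  have hmpos : 0 < m := lt_min hδ₁ (by linarith)
  have hKft : 0 ≤ Kf (t / 2) := hKf _ (by linarith)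
  -- the two dressing factors: `𝒮′ + a` decays at rate `t` (PART 105), `(𝒮′+a) − (𝒮+a) = 𝒮′ − 𝒮` decays at rate `t/2` with size `ε₂` (PART 107)
  have hE' : ∀ b₁ b₂, |(effForm H' Q' + a • (1 : Matrix c c ℝ)) b₁ b₂| ≤ 2 * (Λ + a) * Real.exp (-(t * ρ b₁ b₂)) :=
    abs_effForm_add_le hKf hρ hS hH' hpsd' ha hγ hK' hΛ hUB' hc₀ hδ₀ hP'
  have hdE : ∀ b₁ b₂, |((effForm H' Q' + a • (1 : Matrix c c ℝ)) - (effForm H Q + a • (1 : Matrix c c ℝ))) b₁ b₂| ≤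
      4 * (Λ + a) ^ 2 * ε₂ * Kf (t / 2) ^ 2 * Real.exp (-(t / 2 * ρ b₁ b₂)) := fun b₁ b₂ => by
    have e : (effForm H' Q' + a • (1 : Matrix c c ℝ)) - (effForm H Q + a • (1 : Matrix c c ℝ)) = effForm H' Q' - effForm H Q := by abel
    rw [e]
    have hdiff' : ∀ b b', |(blockProp K' Q' - blockProp K Q) b b'| ≤ ε₂ * Real.exp (-(δ₀ * ρ b b')) := fun b b' => by
      rw [← neg_sub, Matrix.neg_apply, abs_neg]; exact hdiff b b'
    exact abs_effForm_sub_effForm_le hKf hρ hS ha hγ hΛ hc₀ hδ₀ hε₂ hH' hpsd' hK' hUB' hP' hH hpsd hK hUB hP hdiff' b₁ b₂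
  rw [avg_minOp_sub_eq Qf ha hγ hΛ hH hpsd hK hUB hH' hpsd' hK' hUB', Matrix.add_apply]
  refine (abs_add_le _ _).trans ?_
  -- first term: mismatch × (𝒮′ + a)
  have h1 : |((Qf * (K'⁻¹ * Q'ᵀ) - K⁻¹ * Qᵀ) * (effForm H' Q' + a • (1 : Matrix c c ℝ))) x b| ≤
      2 * (Λ + a) * ε₁ * (Kf (m / 2) * Real.exp (-(m / 2 * σ x b))) := by
    rw [Matrix.mul_apply]
    calc |∑ b', (Qf * (K'⁻¹ * Q'ᵀ) - K⁻¹ * Qᵀ) x b' * (effForm H' Q' + a • (1 : Matrix c c ℝ)) b' b|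
        ≤ ∑ b', |(Qf * (K'⁻¹ * Q'ᵀ) - K⁻¹ * Qᵀ) x b' * (effForm H' Q' + a • (1 : Matrix c c ℝ)) b' b| := Finset.abs_sum_le_sum_abs _ _
      _ ≤ ∑ b', ε₁ * Real.exp (-(δ₁ * σ x b')) * (2 * (Λ + a) * Real.exp (-(t * ρ b' b))) := Finset.sum_le_sum fun b' _ => by
          rw [abs_mul]
          exact mul_le_mul (hmis x b') (hE' b' b) (abs_nonneg _) (by positivity)
      _ = 2 * (Λ + a) * ε₁ * ∑ b', Real.exp (-(δ₁ * σ x b')) * Real.exp (-(t * ρ b' b)) := by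
          rw [Finset.mul_sum]; exact Finset.sum_congr rfl fun b' _ => by ring
      _ ≤ 2 * (Λ + a) * ε₁ * (Kf (m / 2) * Real.exp (-(m / 2 * σ x b))) :=
          mul_le_mul_of_nonneg_left (sum_exp_mul_exp_le hρ hS hσ0 hσρ hmpos (min_le_left _ _) ((min_le_right _ _).trans (by linarith)) x b)
            (by positivity)
  -- second term: soft columns × (𝒮′ − 𝒮)
  have h2 : |(K⁻¹ * Qᵀ * ((effForm H' Q' + a • (1 : Matrix c c ℝ)) - (effForm H Q + a • (1 : Matrix c c ℝ)))) x b| ≤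
      4 * (Λ + a) ^ 2 * Kf (t / 2) ^ 2 * c₁ * ε₂ * (Kf (m / 2) * Real.exp (-(m / 2 * σ x b))) := by
    rw [Matrix.mul_apply]
    calc |∑ b', (K⁻¹ * Qᵀ) x b' * ((effForm H' Q' + a • (1 : Matrix c c ℝ)) - (effForm H Q + a • (1 : Matrix c c ℝ))) b' b|
        ≤ ∑ b', |(K⁻¹ * Qᵀ) x b' * ((effForm H' Q' + a • (1 : Matrix c c ℝ)) - (effForm H Q + a • (1 : Matrix c c ℝ))) b' b| :=
          Finset.abs_sum_le_sum_abs _ _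
      _ ≤ ∑ b', c₁ * Real.exp (-(δ₁ * σ x b')) * (4 * (Λ + a) ^ 2 * ε₂ * Kf (t / 2) ^ 2 * Real.exp (-(t / 2 * ρ b' b))) :=
          Finset.sum_le_sum fun b' _ => by
            rw [abs_mul]
            exact mul_le_mul (hT x b') (hdE b' b) (abs_nonneg _) (by positivity)
      _ = 4 * (Λ + a) ^ 2 * Kf (t / 2) ^ 2 * c₁ * ε₂ * ∑ b', Real.exp (-(δ₁ * σ x b')) * Real.exp (-(t / 2 * ρ b' b)) := by
          rw [Finset.mul_sum]; exact Finset.sum_congr rfl fun b' _ => by ring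
      _ ≤ 4 * (Λ + a) ^ 2 * Kf (t / 2) ^ 2 * c₁ * ε₂ * (Kf (m / 2) * Real.exp (-(m / 2 * σ x b))) :=
          mul_le_mul_of_nonneg_left (sum_exp_mul_exp_le hρ hS hσ0 hσρ hmpos (min_le_left _ _) (min_le_right _ _) x b) (by positivity)
  calc |((Qf * (K'⁻¹ * Q'ᵀ) - K⁻¹ * Qᵀ) * (effForm H' Q' + a • (1 : Matrix c c ℝ))) x b| +
        |(K⁻¹ * Qᵀ * ((effForm H' Q' + a • (1 : Matrix c c ℝ)) - (effForm H Q + a • (1 : Matrix c c ℝ)))) x b|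
      ≤ 2 * (Λ + a) * ε₁ * (Kf (m / 2) * Real.exp (-(m / 2 * σ x b))) +
          4 * (Λ + a) ^ 2 * Kf (t / 2) ^ 2 * c₁ * ε₂ * (Kf (m / 2) * Real.exp (-(m / 2 * σ x b))) := add_le_add h1 h2
    _ = (2 * (Λ + a) * ε₁ + 4 * (Λ + a) ^ 2 * Kf (t / 2) ^ 2 * c₁ * ε₂) * Kf (m / 2) * Real.exp (-(m / 2 * σ x b)) := by ring

end End

end Summit.QuantumFields.BalabanUV.Beta.GAN24.HardMinimiserRateTransfer

end
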